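/-
Origin: expansion seat `planner-pub-hodgecm-pv06-g5-0`, handover #4 2026-08-18T11:41Z md5 54e6cfabf9b2; rewrites Pv10g4.LevelLattice->HodgeCM.PerL34.LevelLattice, Pv06g5.ArchCompactK->HodgeCM.PerL34.ArchCompactK (x2); after pv10-g4 #4 (bc51ecd5, tree c35d50e93dee) + #5 (5c3a79cd) [RUN 28 installed] + #6 LevelLattice (013786633f7f) and pv06-g5 #1 (da40467a4fe9); as-landed aslanded/HodgeCM/PerL34/ArchCompactKCocompact.lean 5eef1417e297 (`HOME/pub-hodgecm-pv06-g5/lean/Pv06g5/ArchCompactKCocompact.lean`, md5 54e6cfab, 118 lines);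
landed by the gen-8 packager in gate run 29 as `HodgeCM/PerL34/ArchCompactKCocompact.lean` (import ^import Pv06g5\.ArchCompactK[ \t]*$→import HodgeCM.PerL34.ArchCompactK ×1; import ^import Pv10g4\.LevelLattice[ \t]*$→import HodgeCM.PerL34.LevelLattice ×1; stripped 3 #print/#check/#eval lines).
-/
/-
Origin: pub-hodgecm cell, unit pub-hodgecm-pv06-g5 (DAG-NODE PROVER #06, generation 5), 2026-08-18.
Target path in the package: `HodgeCM/PerL34/ArchCompactKCocompact.lean`; WIP imports ↦ REWRITE
`import Pv10g4.LevelLattice` ↦ `import HodgeCM.PerL34.LevelLattice` (pv10-g4 RUN-29 row #6) and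
`import Pv06g5.ArchCompactK` ↦ `import HodgeCM.PerL34.ArchCompactK` (this seat's row #1).  Lands AFTER both.

# `Γ \ G_U(ℝ) / K_∞` is compact (KERNEL; PerL v5 ll. 70–73 "projective", the compactness half, group level)

pv10-g4's `HodgeCM.Level.compactSpace_quotient_archLattice (hL : finrank ℚ L ≠ 2)` gives `G_U(ℝ)/Γ_∞` compact for
every `Λ : Level V` (Godement: `U(H)` anisotropic when `[L:ℚ] ≠ 2`).  Here: the purely topological step
`G/Γ compact ⇒ Γ\(G/C) compact` for ANY subgroups `Γ, C` of a topological group `G` (the double coset space as the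
orbit space of `Γ` on `G/C`, quotient topology; the map `gΓ ↦ Γ·g⁻¹C` is a continuous surjection `G/Γ → Γ\(G/C)`),
and its instance for PerL: **`Level.compactSpace_orbitQuotient_archK`** — for every level `Λ` and every frame `T`,
`Γ_∞ \ (G_U(ℝ) / K_∞)` is compact, `K_∞ = HermSpace3.archK V T` the constructed compact subgroup of
`HodgeCM/PerL34/ArchCompactK.lean` (so, with a Sylvester frame, `Γ \ (𝔹² × pt)` is compact).  Together with
`HodgeCM/PerL34/ArchCompactKFree.lean` (free action) this is the group-level content of "`Γ\𝔹²` is a compact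
manifold" — the complex structure / projectivity (Kodaira, Baily–Borel) is NOT formalised here and not claimed.
Nothing cited, nothing posited, standard axioms (`#print axioms` below).
-/
import Summits.HodgeConjecture.HodgeCM.PerL34.LevelLattice_2
import Summits.HodgeConjecture.HodgeCM.PerL34.ArchCompactK_2

set_option autoImplicit false

noncomputable section

namespace HodgeCM.PerL34.ArchCompactK

open HodgeCM.PerL34.Godement HodgeCM.PerL34.AdelicUnitaryFactorisation

/-! ## §1 Topological groups: `G/Γ` compact ⇒ `Γ\(G/C)` compact -/

section General

variable {G : Type*} [Group G] (Γ C : Subgroup G)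

/-- The class of `g⁻¹ C` in the orbit space `Γ \ (G / C)` (the double coset space `Γ\G/C`; it carries the quotient
topology of the `Γ`-action on `G/C` when `G` is a topological group). -/
def toOrbitQuotient (g : G) : Quotient (MulAction.orbitRel Γ (G ⧸ C)) :=
  Quotient.mk _ (QuotientGroup.mk g⁻¹ : G ⧸ C)

/-- (Ported verbatim from the HodgeCMPerL package; no docstring in the source.) -/
theorem toOrbitQuotient_surjective : Function.Surjective (toOrbitQuotient Γ C) := by
  intro q
  induction q using Quotient.inductionOn with
  | h x =>
    induction x using QuotientGroup.induction_on with
    | H g => exact ⟨g⁻¹, by simp [toOrbitQuotient]⟩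

/-- `g ↦ Γ g⁻¹ C` is constant on the cosets `gΓ`. -/
theorem toOrbitQuotient_mul_of_mem (g : G) {γ : G} (hγ : γ ∈ Γ) :
    toOrbitQuotient Γ C (g * γ) = toOrbitQuotient Γ C g := by
  apply Quotient.sound
  refine ⟨⟨γ⁻¹, inv_mem hγ⟩, ?_⟩
  change (γ⁻¹ : G) • (QuotientGroup.mk g⁻¹ : G ⧸ C) = QuotientGroup.mk (g * γ)⁻¹
  rw [MulAction.Quotient.smul_mk, smul_eq_mul, mul_inv_rev]

/-- The surjection `G/Γ → Γ\(G/C)`, `gΓ ↦ Γ g⁻¹ C`. -/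
def orbitQuotientOfQuotient : G ⧸ Γ → Quotient (MulAction.orbitRel Γ (G ⧸ C)) :=
  Quotient.lift (s := QuotientGroup.leftRel Γ) (toOrbitQuotient Γ C) (fun a b hab => by
    have hab' : a⁻¹ * b ∈ Γ := QuotientGroup.leftRel_apply.mp hab
    have hb : b = a * (a⁻¹ * b) := by rw [mul_inv_cancel_left]
    rw [hb, toOrbitQuotient_mul_of_mem Γ C a hab'])

/-- (Ported verbatim from the HodgeCMPerL package; no docstring in the source.) -/
theorem orbitQuotientOfQuotient_mk (g : G) :
    orbitQuotientOfQuotient Γ C (QuotientGroup.mk g) = toOrbitQuotient Γ C g := rfl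

/-- (Ported verbatim from the HodgeCMPerL package; no docstring in the source.) -/
theorem orbitQuotientOfQuotient_surjective : Function.Surjective (orbitQuotientOfQuotient Γ C) := by
  intro q
  obtain ⟨g, rfl⟩ := toOrbitQuotient_surjective Γ C q
  exact ⟨QuotientGroup.mk g, rfl⟩

variable [TopologicalSpace G] [IsTopologicalGroup G]

/-- (Ported verbatim from the HodgeCMPerL package; no docstring in the source.) -/
theorem continuous_toOrbitQuotient : Continuous (toOrbitQuotient Γ C) :=
  continuous_quot_mk.comp (QuotientGroup.continuous_mk.comp continuous_inv)

/-- (Ported verbatim from the HodgeCMPerL package; no docstring in the source.) -/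
theorem continuous_orbitQuotientOfQuotient : Continuous (orbitQuotientOfQuotient Γ C) :=
  (continuous_toOrbitQuotient Γ C).quotient_lift _

/-- **`G/Γ` compact ⇒ `Γ\(G/C)` compact** (any subgroups `Γ`, `C` of a topological group). -/
theorem compactSpace_orbitQuotient [CompactSpace (G ⧸ Γ)] :
    CompactSpace (Quotient (MulAction.orbitRel Γ (G ⧸ C))) :=
  ⟨by
    rw [← (orbitQuotientOfQuotient_surjective Γ C).range_eq]
    exact isCompact_range (continuous_orbitQuotientOfQuotient Γ C)⟩

end General

/-! ## §2 PerL: `Γ \ G_U(ℝ) / K_∞` is compact (`[L:ℚ] ≠ 2`) -/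

section PerL

variable (L : CMField) {ι₁ : L →+* ℂ} (V : HermSpace3 L ι₁)

/-- **For every level `Λ` and every frame `T`: `Γ_∞ \ (G_U(ℝ) / K_∞)` is compact** when `[L:ℚ] ≠ 2`
(`K_∞ = HermSpace3.archK V T`; with a Sylvester frame, `Γ \ (𝔹² × pt)` is compact). -/
theorem _root_.HodgeCM.Level.compactSpace_orbitQuotient_archK (hL : Module.finrank ℚ L ≠ 2) (Λ : Level V)
    (T : GL (Fin 3) ℂ) :
    CompactSpace (Quotient (MulAction.orbitRel (archLattice L V.Hm Λ.Γ) (Uinf L V.Hm ⧸ V.archK T))) := by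
  haveI := HodgeCM.Level.compactSpace_quotient_archLattice L V Λ hL
  exact compactSpace_orbitQuotient (archLattice L V.Hm Λ.Γ) (V.archK T)

/-- The same for the adelic congruence lattices `Γ_{K_f}`, `K_f ≤ G_U(𝔸_f)` compact open. -/
theorem _root_.HodgeCM.HermSpace3.compactSpace_orbitQuotient_congruenceLattice_archK (hL : Module.finrank ℚ L ≠ 2)
    (Kf : Subgroup (Ufin L V.Hm)) (hKo : IsOpen (Kf : Set (Ufin L V.Hm))) (T : GL (Fin 3) ℂ) :
    CompactSpace (Quotient (MulAction.orbitRel (congruenceLattice L V.Hm Kf) (Uinf L V.Hm ⧸ V.archK T))) := by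
  haveI := HodgeCM.HermSpace3.compactSpace_quotient_congruenceLattice L V hL Kf hKo
  exact compactSpace_orbitQuotient (congruenceLattice L V.Hm Kf) (V.archK T)

end PerL

end HodgeCM.PerL34.ArchCompactK

end

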